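import Summits.ResolutionOfSingularities.ResolutionOfSingularities.Theorems.WeightedInvariantWeightedFiltrationComparison
import Summits.ResolutionOfSingularities.ResolutionOfSingularities.Theorems.WeightedInvariantGermContractionChart
import Literature.AlgebraicGeometry.Resolution.StrictNormalCrossingsAt
import Mathlib.RingTheory.GradedAlgebra.Homogeneous.Ideal
import Mathlib.LinearAlgebra.FiniteDimensional.Lemmas
import HarnessLib

/-!
# Homogeneous chart parameters for the orbit-wise centre, chosen at the generic point

Route `ResolutionOfSingularities/WeightedInvariant`, door crux `HypersurfaceCentreConstruction`
(stmt-ResolutionOfSingularities-19897) — OURS, helper; e-ladder `e = 1`, registered stub `stub_e1_centre` of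
`res-L1-w43-stub-10` (cell res-hironaka, `D/res-D-pv-025/DOOR-ELADDER-PLAN.md` §7–§8, sub-lemma **L0-charts**, step
«re-choose the parameters HOMOGENEOUS»).

The centre of rung `e = 1` along the orbit closure `𝒬 = closure {η}` is contracted from the Abramovich–Quek–Schober
germ `𝒥ₙ(x; w) ⊆ 𝒪_{Y,η}` (`x = (x₀, x₁)` a regular system of parameters of the 2-dimensional regular local ring
`𝒪_{Y,η}`, weights `w₁ ≤ w₀`).  To exhibit weighted charts at the OTHER points of `𝒬` one needs sections `f₀, f₁`
on a torus chart `W ∋ η` which (a) are HOMOGENEOUS for the chart grading (so that everything they define is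
torus-stable and propagates along the graded-simple orbit), (b) vanish on `𝒬`, and (c) have germs at `η` spanning the
SAME weighted filtration as `x`.  This file produces them from the homogeneity of two ideals of `Γ(Y, W)` — the prime
`𝔭_η` of `η` (invariant (I2)) and the contracted piece `J_{w₀} = Γ(Y, W) ∩ 𝒥_{w₀}(x)` (the `(hom)` lemma L3) —:

* `exists_homogeneous_mem_not_mem` — a homogeneous ideal not contained in `K` has a HOMOGENEOUS element outside `K`;
* `not_maximalIdeal_le_sq_sup_span_singleton` — in a Noetherian local ring of dimension `≠ ≤ 1` … precisely: if
  `spanFinrank 𝔪 = dim R = 2` then `𝔪 ⊄ 𝔪² + (g)` for every `g` (Nakayama);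
* `linearIndependent_toCotangent_pair` — `f₀ ∉ 𝔪²`, `f₁ ∉ 𝔪² + (f₀)` ⇒ `df₀, df₁` independent in `𝔪/𝔪²`;
  `span_pair_eq_maximalIdeal_of_linearIndependent` — in a regular local ring of dimension `2` they then span `𝔪`;
* **`exists_homogeneous_orbitChartParameters`** — for `η ∈ W` with `𝒪_{Y,η}` regular of dimension `2`, `x` spanning
  `𝔪_η`, weights `0 < w₁ ≤ w₀`, `𝔭_η` and `J_{w₀}` homogeneous: there are homogeneous `f₀, f₁ ∈ 𝔭_η ⊆ Γ(Y, W)` whose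
  germs at `η` span `𝔪_η`, have independent differentials, and satisfy `𝒥ₙ(germ f; w) = 𝒥ₙ(x; w)` for all `n`
  (`weightedMonomialIdeal_eq_of_height_two`).

No named facts. AI-written; weaker than expert review.
-/

noncomputable section

set_option linter.dupNamespace false -- mandated namespace of this single-conjunct summit

namespace Summit.ResolutionOfSingularities.ResolutionOfSingularities.Theorems

universe u

open CategoryTheory AlgebraicGeometry TopologicalSpace IsLocalRing Opposite
open Literature.AlgebraicGeometry.Resolution

/-! ## Homogeneous avoidance -/

/-- **A homogeneous ideal not contained in `K` contains a homogeneous element outside `K`.** [folklore] -/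
theorem exists_homogeneous_mem_not_mem {ι A : Type*} [DecidableEq ι] [AddMonoid ι] [CommRing A]
    (𝒜 : ι → AddSubgroup A) [GradedRing 𝒜] {I K : Ideal A} (hI : I.IsHomogeneous 𝒜) (h : ¬ I ≤ K) :
    ∃ (d : ι) (x : A), x ∈ 𝒜 d ∧ x ∈ I ∧ x ∉ K := by
  classical
  obtain ⟨x, hxI, hxK⟩ := SetLike.not_le_iff_exists.mp h
  have hcomp : ∃ d, (DirectSum.decompose 𝒜 x d : A) ∉ K := by
    by_contra hall
    push Not at hall
    apply hxK
    rw [← DirectSum.sum_support_decompose 𝒜 x]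
    exact Ideal.sum_mem _ fun d _ => hall d
  obtain ⟨d, hd⟩ := hcomp
  exact ⟨d, _, SetLike.coe_mem _, hI d hxI, hd⟩

/-! ## Two parameters in a regular local ring of dimension two -/

section LocalAlgebra

variable {R : Type u} [CommRing R]

/-- In a Noetherian local ring whose maximal ideal needs (at least) two generators, `𝔪 ⊄ 𝔪² + (g)` for every
`g` (else `𝔪 = (g)` by Nakayama). [folklore] -/
theorem not_maximalIdeal_le_sq_sup_span_singleton [IsLocalRing R] [IsNoetherianRing R]
    (h2 : 2 ≤ (maximalIdeal R).spanFinrank) {g : R} (hg : g ∈ maximalIdeal R) :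
    ¬ maximalIdeal R ≤ maximalIdeal R ^ 2 ⊔ Ideal.span {g} := by
  intro hle
  have hle' : maximalIdeal R ≤ Ideal.span {g} ⊔ maximalIdeal R • maximalIdeal R := by
    rwa [smul_eq_mul, ← pow_two, sup_comm]
  have hm : maximalIdeal R ≤ Ideal.span {g} :=
    Submodule.le_of_le_smul_of_le_jacobson_bot (IsNoetherian.noetherian _)
      (IsLocalRing.maximalIdeal_le_jacobson ⊥) hle'
  have heq : maximalIdeal R = Ideal.span {g} :=
    le_antisymm hm (Ideal.span_le.mpr (Set.singleton_subset_iff.mpr hg))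
  have h1 : (maximalIdeal R).spanFinrank ≤ 1 := by
    rw [heq]
    simpa using Submodule.spanFinrank_span_le_ncard_of_finite (Set.finite_singleton g)
  omega

/-- A regular local ring of Krull dimension `2` has `spanFinrank 𝔪 = 2`. [folklore] -/
theorem spanFinrank_maximalIdeal_eq_two [IsRegularLocalRing R]
    (hdim : ringKrullDim R = ((2 : ℕ) : WithBot ℕ∞)) : (maximalIdeal R).spanFinrank = 2 := by
  have h := IsRegularLocalRing.spanFinrank_maximalIdeal (R := R)
  rw [hdim] at h
  exact_mod_cast h

/-- **Two elements with `f₀ ∉ 𝔪²` and `f₁ ∉ 𝔪² + (f₀)` have independent differentials.** [folklore] -/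
theorem linearIndependent_toCotangent_pair [IsLocalRing R] (f : Fin 2 → R) (hf : ∀ i, f i ∈ maximalIdeal R)
    (h0 : f 0 ∉ maximalIdeal R ^ 2) (h1 : f 1 ∉ maximalIdeal R ^ 2 ⊔ Ideal.span {f 0}) :
    LinearIndependent (ResidueField R) fun i => (maximalIdeal R).toCotangent ⟨f i, hf i⟩ := by
  rw [Literature.AlgebraicGeometry.Resolution.linearIndependent_toCotangent_iff_forall_mem f hf]
  intro c hc
  rw [Fin.sum_univ_two] at hc
  -- `c₁ ∈ 𝔪`
  have hc1 : c 1 ∈ maximalIdeal R := by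
    by_contra hc1
    have hu : IsUnit (c 1) := by simpa [mem_maximalIdeal, mem_nonunits_iff] using hc1
    obtain ⟨b, hb⟩ := hu.exists_left_inv
    apply h1
    have : f 1 = b * (c 0 * f 0 + c 1 * f 1) - (b * c 0) * f 0 := by
      rw [mul_add, ← mul_assoc b (c 1), hb, one_mul, mul_assoc]; ring
    rw [this]
    exact Ideal.sub_mem _ (Ideal.mem_sup_left (Ideal.mul_mem_left _ _ hc))
      (Ideal.mem_sup_right (Ideal.mem_span_singleton'.mpr ⟨b * c 0, rfl⟩))
  -- `c₀ ∈ 𝔪`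
  have hc0 : c 0 ∈ maximalIdeal R := by
    by_contra hc0
    have hu : IsUnit (c 0) := by simpa [mem_maximalIdeal, mem_nonunits_iff] using hc0
    obtain ⟨b, hb⟩ := hu.exists_left_inv
    apply h0
    have h2 : c 0 * f 0 ∈ maximalIdeal R ^ 2 := by
      have : c 0 * f 0 = (c 0 * f 0 + c 1 * f 1) - c 1 * f 1 := by ring
      rw [this, pow_two]
      exact Ideal.sub_mem _ (by rw [← pow_two]; exact hc) (Ideal.mul_mem_mul hc1 (hf 1))
    have : f 0 = b * (c 0 * f 0) := by rw [← mul_assoc, hb, one_mul]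
    rw [this]
    exact Ideal.mul_mem_left _ _ h2
  intro i
  fin_cases i <;> assumption

/-- **In a regular local ring of dimension `2`, two elements of `𝔪` with independent differentials span `𝔪`.**
[folklore] -/
theorem span_pair_eq_maximalIdeal_of_linearIndependent [IsRegularLocalRing R]
    (hdim : ringKrullDim R = ((2 : ℕ) : WithBot ℕ∞)) (f : Fin 2 → R) (hf : ∀ i, f i ∈ maximalIdeal R)
    (hli : LinearIndependent (ResidueField R) fun i => (maximalIdeal R).toCotangent ⟨f i, hf i⟩) :
    Ideal.span (Set.range f) = maximalIdeal R := by
  have hfin : Module.finrank (ResidueField R) (CotangentSpace R) = 2 := by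
    rw [← spanFinrank_maximalIdeal_eq_finrank_cotangentSpace]
    exact spanFinrank_maximalIdeal_eq_two hdim
  have htop := hli.span_eq_top_of_card_eq_finrank (by rw [hfin]; simp)
  -- from the cotangent space back to `𝔪`
  have hs : Submodule.span (ResidueField R)
      ((maximalIdeal R).toCotangent '' Set.range (fun i => (⟨f i, hf i⟩ : maximalIdeal R))) = ⊤ := by
    rw [← Set.range_comp]
    exact htop
  rw [CotangentSpace.span_image_eq_top_iff] at hs
  have := congr_arg (Submodule.map (maximalIdeal R).subtype) hs
  rw [Submodule.map_span, Submodule.map_top, Submodule.range_subtype, ← Set.range_comp] at this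
  exact this

end LocalAlgebra

/-! ## Homogeneous parameters on a torus chart through the generic point of the orbit -/

section Chart

variable {Y : Scheme.{u}} (W : Y.affineOpens) {ιg : Type*} [DecidableEq ιg] [AddMonoid ιg]
  (𝒜 : ιg → AddSubgroup Γ(Y, W)) [GradedRing 𝒜] {η : Y} (hηW : η ∈ (W : Y.Opens))

/-- **Homogeneous chart parameters along the orbit, chosen at its generic point.**  Let `η ∈ W` (affine, with a
grading `𝒜` of `Γ(Y, W)`) have a regular 2-dimensional local ring, let `x = (x₀, x₁)` span `𝔪_η`, `0 < w₁ ≤ w₀`,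
and assume the prime `𝔭_η ⊆ Γ(Y, W)` and the contracted piece `Γ(Y, W) ∩ 𝒥_{w₀}(x; w)` are homogeneous.  Then there
are HOMOGENEOUS sections `f₀, f₁ ∈ 𝔭_η` whose germs at `η` span `𝔪_η`, have independent differentials, and span
the same weighted filtration as `x`: `𝒥ₙ(germ f; w) = 𝒥ₙ(x; w)` for all `n`. [folklore] -/
theorem exists_homogeneous_orbitChartParameters [IsRegularLocalRing (Y.presheaf.stalk η)]
    (hdim : ringKrullDim (Y.presheaf.stalk η) = ((2 : ℕ) : WithBot ℕ∞))
    (x : Fin 2 → Y.presheaf.stalk η) (w : Fin 2 → ℕ) (hw1 : 0 < w 1) (hw : w 1 ≤ w 0)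
    (hx : Ideal.span (Set.range x) = maximalIdeal (Y.presheaf.stalk η))
    (hP : ((W.2.primeIdealOf ⟨η, hηW⟩).asIdeal).IsHomogeneous 𝒜)
    (hJ : (germContractionIdeal η (weightedMonomialIdeal x w (w 0)) W).IsHomogeneous 𝒜) :
    ∃ (f : Fin 2 → Γ(Y, W)) (d : Fin 2 → ιg), (∀ i, f i ∈ 𝒜 (d i)) ∧
      (∀ i, f i ∈ (W.2.primeIdealOf ⟨η, hηW⟩).asIdeal) ∧
      ∃ hf : ∀ i, (Y.presheaf.germ (W : Y.Opens) η hηW).hom (f i) ∈ maximalIdeal (Y.presheaf.stalk η),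
        Ideal.span (Set.range fun i => (Y.presheaf.germ (W : Y.Opens) η hηW).hom (f i)) =
          maximalIdeal (Y.presheaf.stalk η) ∧
        LinearIndependent (ResidueField (Y.presheaf.stalk η))
          (fun i => (maximalIdeal (Y.presheaf.stalk η)).toCotangent ⟨_, hf i⟩) ∧
        ∀ n, weightedMonomialIdeal (fun i => (Y.presheaf.germ (W : Y.Opens) η hηW).hom (f i)) w n =
          weightedMonomialIdeal x w n := by
  -- notation and the localisation structure of the stalk
  letI : Algebra Γ(Y, W) (Y.presheaf.stalk η) := TopCat.Presheaf.algebra_section_stalk Y.presheaf ⟨η, hηW⟩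
  have hloc : IsLocalization.AtPrime (Y.presheaf.stalk η) (W.2.primeIdealOf ⟨η, hηW⟩).asIdeal :=
    W.2.isLocalization_stalk ⟨η, hηW⟩
  have hφ : (Y.presheaf.germ (W : Y.Opens) η hηW).hom = algebraMap Γ(Y, W) (Y.presheaf.stalk η) := rfl
  have h2 : 2 ≤ (maximalIdeal (Y.presheaf.stalk η)).spanFinrank := (spanFinrank_maximalIdeal_eq_two hdim).ge
  have hxm : ∀ i, x i ∈ maximalIdeal (Y.presheaf.stalk η) := fun i =>
    hx ▸ Ideal.subset_span (Set.mem_range_self i)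
  -- `𝔭 · O = 𝔪`
  have h𝔭map : ((W.2.primeIdealOf ⟨η, hηW⟩).asIdeal).map (Y.presheaf.germ (W : Y.Opens) η hηW).hom = maximalIdeal (Y.presheaf.stalk η) := by
    rw [hφ]; exact IsLocalization.AtPrime.map_eq_maximalIdeal (W.2.primeIdealOf ⟨η, hηW⟩).asIdeal (Y.presheaf.stalk η)
  -- membership in `𝔭` is vanishing at `η`
  have hmem𝔭 : ∀ s : Γ(Y, W), s ∈ (W.2.primeIdealOf ⟨η, hηW⟩).asIdeal ↔ (Y.presheaf.germ (W : Y.Opens) η hηW).hom s ∈ maximalIdeal (Y.presheaf.stalk η) := fun s =>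
    (germ_mem_maximalIdeal_iff_mem_primeIdealOf W hηW s).symm
  -- (1) `x₀ ∉ 𝔪²`, hence `J_{w₀} ⊄ φ⁻¹(𝔪²)`
  have hx0 : x 0 ∉ maximalIdeal (Y.presheaf.stalk η) ^ 2 := by
    intro hx0
    apply not_maximalIdeal_le_sq_sup_span_singleton h2 (hxm 1)
    have h : Ideal.span (Set.range x) ≤ maximalIdeal (Y.presheaf.stalk η) ^ 2 ⊔ Ideal.span {x 1} := by
      rw [Ideal.span_le]
      rintro _ ⟨i, rfl⟩
      fin_cases i
      · exact Ideal.mem_sup_left hx0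
      · exact Ideal.mem_sup_right (Ideal.subset_span rfl)
    rwa [hx] at h
  have hJ' : ¬ germContractionIdeal η (weightedMonomialIdeal x w (w 0)) W ≤ (maximalIdeal (Y.presheaf.stalk η) ^ 2).comap (Y.presheaf.germ (W : Y.Opens) η hηW).hom := by
    intro hle
    apply hx0
    have hmap : (germContractionIdeal η (weightedMonomialIdeal x w (w 0)) W).map (Y.presheaf.germ (W : Y.Opens) η hηW).hom =
        weightedMonomialIdeal x w (w 0) := by
      rw [germContractionIdeal_of_mem η _ hηW, hφ]
      exact IsLocalization.map_under (W.2.primeIdealOf ⟨η, hηW⟩).asIdeal.primeCompl (Y.presheaf.stalk η) _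
    have := Ideal.map_mono (f := (Y.presheaf.germ (W : Y.Opens) η hηW).hom) hle
    rw [hmap] at this
    exact (this.trans Ideal.map_comap_le) (self_mem_weightedMonomialIdeal x w 0)
  obtain ⟨d₀, f₀, hf₀d, hf₀J, hf₀K⟩ := exists_homogeneous_mem_not_mem 𝒜 hJ hJ'
  rw [Ideal.mem_comap] at hf₀K
  have hf₀𝒥 : (Y.presheaf.germ (W : Y.Opens) η hηW).hom f₀ ∈ weightedMonomialIdeal x w (w 0) :=
    (mem_germContractionIdeal_iff η _ hηW f₀).mp hf₀J
  have hf₀m : (Y.presheaf.germ (W : Y.Opens) η hηW).hom f₀ ∈ maximalIdeal (Y.presheaf.stalk η) := by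
    have h1 : weightedMonomialIdeal x w (w 0) ≤ maximalIdeal (Y.presheaf.stalk η) := by
      rw [weightedMonomialIdeal_eq_span_weightedMonomials]
      exact (span_weightedMonomials_le_span x w (hw1.trans_le hw)).trans (le_of_eq hx)
    exact h1 hf₀𝒥
  have hf₀𝔭 : f₀ ∈ (W.2.primeIdealOf ⟨η, hηW⟩).asIdeal := (hmem𝔭 f₀).mpr hf₀m
  -- (2) `𝔭 ⊄ φ⁻¹(𝔪² + ((Y.presheaf.germ (W : Y.Opens) η hηW).hom f₀))`
  have hP' : ¬ (W.2.primeIdealOf ⟨η, hηW⟩).asIdeal ≤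
      (maximalIdeal (Y.presheaf.stalk η) ^ 2 ⊔
        Ideal.span {(Y.presheaf.germ (W : Y.Opens) η hηW).hom f₀}).comap (Y.presheaf.germ (W : Y.Opens) η hηW).hom := by
    intro hle
    have h := (Ideal.map_mono (f := (Y.presheaf.germ (W : Y.Opens) η hηW).hom) hle).trans Ideal.map_comap_le
    rw [h𝔭map] at h
    exact not_maximalIdeal_le_sq_sup_span_singleton h2 hf₀m h
  obtain ⟨d₁, f₁, hf₁d, hf₁𝔭, hf₁K⟩ := exists_homogeneous_mem_not_mem 𝒜 hP hP'
  rw [Ideal.mem_comap] at hf₁K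
  have hf₁m : (Y.presheaf.germ (W : Y.Opens) η hηW).hom f₁ ∈ maximalIdeal (Y.presheaf.stalk η) := (hmem𝔭 f₁).mp hf₁𝔭
  -- assemble
  let f : Fin 2 → Γ(Y, W) := ![f₀, f₁]
  have hfm : ∀ i, (Y.presheaf.germ (W : Y.Opens) η hηW).hom (f i) ∈ maximalIdeal (Y.presheaf.stalk η) := fun i => by fin_cases i <;> assumption
  have hli : LinearIndependent (ResidueField (Y.presheaf.stalk η)) fun i => (maximalIdeal (Y.presheaf.stalk η)).toCotangent ⟨(Y.presheaf.germ (W : Y.Opens) η hηW).hom (f i), hfm i⟩ :=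
    linearIndependent_toCotangent_pair (fun i => (Y.presheaf.germ (W : Y.Opens) η hηW).hom (f i)) hfm hf₀K hf₁K
  have hspan : Ideal.span (Set.range fun i => (Y.presheaf.germ (W : Y.Opens) η hηW).hom (f i)) = maximalIdeal (Y.presheaf.stalk η) :=
    span_pair_eq_maximalIdeal_of_linearIndependent hdim _ hfm hli
  refine ⟨f, ![d₀, d₁], fun i => by fin_cases i <;> assumption, fun i => by fin_cases i <;> assumption,
    hfm, hspan, hli, fun n => ?_⟩
  exact weightedMonomialIdeal_eq_of_height_two x (fun i => (Y.presheaf.germ (W : Y.Opens) η hηW).hom (f i)) w hw1 hw hx hspan hf₀𝒥 hf₀K n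

end Chart

end Summit.ResolutionOfSingularities.ResolutionOfSingularities.Theorems

end
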